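import Mathlib
import Literature.NumberTheory.Transcendental.AssociatorsEvalProofs
import HarnessLib

/-!
# Associators IV: hexagons from the 2- and 3-cycle relations [Furusho2010, Lemma 7]

Third proofs file towards [Furusho2010, Thm 1] (`furusho_pentagon_hexagon`), continuing
`AssociatorsProofs.lean` (Lemma 6: pentagon ⇒ 2-cycle) and `AssociatorsEvalProofs.lean`
(substitution calculus, central shifts). It formalises the direction of [Furusho2010, Lemma 7]
(= [Drinfeld1991, §5]) used in the proof of Thm 1:

> `L EMMA 7. Let φ be a group-like element. Giving two hexagon equations (2) and (3) for φ is
> equivalent to giving the 2-cycle relation (12) and the 3-cycle relation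
> (13) `e^{μX/2} φ(Z,X) e^{μZ/2} φ(Y,Z) e^{μY/2} φ(X,Y) = 1` with `X + Y + Z = 0`.`

Contents:

1. `truncExp R N a = Σ_{m ≤ N} aᵐ/m!` — the truncated exponential in an algebra over a
   `ℚ`-algebra `R` (`DrinfeldKohnoTrunc.expT` is the case of `U𝔞₄/(deg > N)`); functoriality
   (`map_truncExp`) and, via Mathlib's `IsNilpotent.exp`, `e^{a+b} = e^a e^b` for commuting
   nilpotents (`truncExp_add_of_commute`) with the inverses `e^{a} e^{-a} = 1`.
2. Nilpotency in the truncated Drinfeld–Kohno algebra: every product of more than `N` elements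
   of the span of the generators vanishes (`DrinfeldKohnoTrunc.list_prod_eq_zero_of_mem_genSpan`),
   so substitutions with values in that span are `(N+1)`-nilpotent.
3. `NCSeries.ThreeCycle μ φ` — Furusho's 3-cycle relation (13), truncation by truncation in the
   truncated free algebra `k⟨⟨X,Y⟩⟩/(deg > N)`; the evaluated 2-cycle relation
   `φ(a,b) φ(b,a) = 1` (`NCSeries.two_cycle_eval`).
4. **[Furusho2010, Lemma 7 (⇐)]** `NCSeries.drinfeldHexagons_of_threeCycle`: a group-like `φ`
   with `c_X(φ) = c_Y(φ) = 0` satisfying the 2-cycle relation and the 3-cycle relation for `μ`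
   satisfies both hexagon equations `NCSeries.DrinfeldHexagon μ φ`, `NCSeries.DrinfeldHexagonB μ φ`.
   Proof as printed: in `U𝔞₃`, `c = t₁₂ + t₁₃ + t₂₃` commutes with `t₁₂, t₁₃, t₂₃`, so with
   `X = t₁₂, Y = t₂₃, Z = -X - Y` one has `t₁₃ = Z + c`, the central shifts remove `c` from the
   arguments of `φ`, and `e^{μ t₁₃/2} = e^{μc/2} e^{μZ/2}`; the hexagons then reduce to (13) and to
   (13) with `X, Y` exchanged.

With `NCSeries.DrinfeldPentagon.two_cycle` this reduces `furusho_pentagon_hexagon` to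
"pentagon ⇒ 3-cycle for `μ = ±(24 c₂(φ))^{1/2}`" ([Furusho2010, Thm 10 + Lemma 9]), not
formalised here. No named facts are introduced.

## References

* H. Furusho, *Pentagon and hexagon equations*, Ann. of Math. 171 (2010), 545–556, §2,
  Lemma 7. [Furusho2010]
* V. G. Drinfel'd, *On quasitriangular quasi-Hopf algebras and on a group that is closely
  connected with Gal(Q̄/Q)*, Leningrad Math. J. 2 (1991), 829–860, §5. [Drinfeld1991]
-/

noncomputable section

open scoped BigOperators

namespace Literature.NumberTheory.Transcendental

universe u v

/-! ## 1. Truncated exponentials -/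

section TruncExp

variable (R : Type v) [CommRing R] [Algebra ℚ R] {A : Type*} [Ring A] [Algebra R A]

/-- The **truncated exponential** `Σ_{m ≤ N} aᵐ/m!` in an algebra over a `ℚ`-algebra `R`; it is
the exponential of every `a` with `a^{N+1} = 0`. [folklore] -/
def truncExp (N : ℕ) (a : A) : A :=
  ∑ m ∈ Finset.range (N + 1), algebraMap ℚ R (1 / (m.factorial : ℚ)) • a ^ m

variable {R}

/-- `DrinfeldKohnoTrunc.expT` is the truncated exponential of `U𝔞/(deg > N)`. [folklore] -/
theorem DrinfeldKohnoTrunc.expT_eq_truncExp {ι : Type*} {N : ℕ} (x : DrinfeldKohnoTrunc R ι N) :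
    DrinfeldKohnoTrunc.expT x = truncExp R N x := rfl

/-- Truncated exponentials are preserved by algebra morphisms. [folklore] -/
theorem map_truncExp {B : Type*} [Ring B] [Algebra R B] (F : A →ₐ[R] B) (N : ℕ) (a : A) :
    F (truncExp R N a) = truncExp R N (F a) := by
  simp [truncExp, map_sum, map_pow]

/-- `truncExp R N 0 = 1`. [folklore] -/
@[simp] theorem truncExp_zero (N : ℕ) : truncExp R N (0 : A) = 1 := by
  unfold truncExp
  rw [Finset.sum_eq_single_of_mem 0 (by simp) (fun m _ hm => by simp [zero_pow hm])]
  simp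

/-- **`e^{a+b} = e^a e^b` for commuting nilpotents**, for the truncated exponential at any level
`N` with `a^{N+1} = b^{N+1} = (a+b)^{N+1} = 0` (via Mathlib's `IsNilpotent.exp`). [folklore] -/
theorem truncExp_add_of_commute (N : ℕ) {a b : A} (hab : Commute a b) (ha : a ^ (N + 1) = 0)
    (hb : b ^ (N + 1) = 0) (hab' : (a + b) ^ (N + 1) = 0) :
    truncExp R N (a + b) = truncExp R N a * truncExp R N b := by
  letI : Module ℚ A := Module.compHom A (algebraMap ℚ R)
  have key : ∀ {c : A}, c ^ (N + 1) = 0 → truncExp R N c = IsNilpotent.exp c := fun {c} hc => by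
    rw [IsNilpotent.exp_eq_sum hc]
    refine Finset.sum_congr rfl fun m _ => ?_
    rw [one_div]
    rfl
  rw [key hab', key ha, key hb]
  exact IsNilpotent.exp_add_of_commute hab ⟨N + 1, ha⟩ ⟨N + 1, hb⟩

/-- `e^{a} e^{-a} = 1` for `a^{N+1} = 0`. [folklore] -/
theorem truncExp_mul_truncExp_neg (N : ℕ) {a : A} (ha : a ^ (N + 1) = 0) :
    truncExp R N a * truncExp R N (-a) = 1 := by
  have hna : (-a) ^ (N + 1) = 0 := by rw [neg_pow, ha, mul_zero]
  rw [← truncExp_add_of_commute N (Commute.neg_right (Commute.refl a)) ha hna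
    (by rw [add_neg_cancel, zero_pow (Nat.succ_ne_zero _)]), add_neg_cancel, truncExp_zero]

/-- `e^{-a} e^{a} = 1` for `a^{N+1} = 0`. [folklore] -/
theorem truncExp_neg_mul_truncExp (N : ℕ) {a : A} (ha : a ^ (N + 1) = 0) :
    truncExp R N (-a) * truncExp R N a = 1 := by
  have hna : (-a) ^ (N + 1) = 0 := by rw [neg_pow, ha, mul_zero]
  rw [← truncExp_add_of_commute N (Commute.neg_left (Commute.refl a)) hna ha
    (by rw [neg_add_cancel, zero_pow (Nat.succ_ne_zero _)]), neg_add_cancel, truncExp_zero]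

/-- An element commuting with `a` commutes with `e^a`. [folklore] -/
theorem Commute.truncExp_right {e a : A} (h : Commute e a) (N : ℕ) : Commute e (truncExp R N a) :=
  Commute.sum_right _ _ _ fun m _ => (h.pow_right m).smul_right _

end TruncExp

/-! ## 2. Nilpotency in the truncated Drinfeld–Kohno algebra -/

namespace DrinfeldKohnoTrunc

variable {R : Type u} [CommRing R] {ι : Type v} {N : ℕ}

/-- The `R`-submodule spanned by the generators `t i j` (the weight-one part). [folklore] -/
def genSpan : Submodule R (DrinfeldKohnoTrunc R ι N) :=
  Submodule.span R (Set.range fun p : ι × ι => t R N p.1 p.2)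

/-- `t i j ∈ genSpan`. [folklore] -/
theorem t_mem_genSpan (i j : ι) : t R N i j ∈ (genSpan : Submodule R (DrinfeldKohnoTrunc R ι N)) :=
  Submodule.subset_span ⟨(i, j), rfl⟩

/-- The `R`-submodule spanned by the products of `m` generators (the weight-`m` part).
[folklore] -/
def prodSpan (m : ℕ) : Submodule R (DrinfeldKohnoTrunc R ι N) :=
  Submodule.span R (Set.range fun g : Fin m → ι × ι => (List.ofFn fun r => t R N (g r).1 (g r).2).prod)

/-- `(weight 1) · (weight m) ⊆ weight (m + 1)`. [folklore] -/
theorem genSpan_mul_prodSpan_le (m : ℕ) :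
    (genSpan : Submodule R (DrinfeldKohnoTrunc R ι N)) * prodSpan m ≤ prodSpan (m + 1) := by
  rw [genSpan, prodSpan, Submodule.span_mul_span, Submodule.span_le]
  rintro _ ⟨_, ⟨p, rfl⟩, _, ⟨g, rfl⟩, rfl⟩
  refine Submodule.subset_span ⟨Fin.cons p g, ?_⟩
  simp [List.ofFn_succ]

/-- Weight `N + 1` vanishes in the truncation. [folklore] -/
theorem prodSpan_succ_eq_bot : (prodSpan (N + 1) : Submodule R (DrinfeldKohnoTrunc R ι N)) = ⊥ := by
  rw [prodSpan, Submodule.span_eq_bot]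
  rintro _ ⟨g, rfl⟩
  exact prod_t_eq_zero g

/-- A product of weight-one elements has the weight of its length. [folklore] -/
theorem list_prod_mem_prodSpan : ∀ (L : List (DrinfeldKohnoTrunc R ι N)),
    (∀ x ∈ L, x ∈ (genSpan : Submodule R (DrinfeldKohnoTrunc R ι N))) → L.prod ∈ prodSpan L.length
  | [], _ => by
    rw [List.prod_nil, List.length_nil]
    exact Submodule.subset_span ⟨fun i => i.elim0, by simp⟩
  | x :: L, h => by
    rw [List.prod_cons, List.length_cons]
    exact genSpan_mul_prodSpan_le _ (Submodule.mul_mem_mul (h x (by simp))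
      (list_prod_mem_prodSpan L fun y hy => h y (by simp [hy])))

/-- **Every product of more than `N` weight-one elements vanishes** in `U𝔞/(deg > N)`.
[folklore] -/
theorem list_prod_eq_zero_of_mem_genSpan (L : List (DrinfeldKohnoTrunc R ι N))
    (hL : ∀ x ∈ L, x ∈ (genSpan : Submodule R (DrinfeldKohnoTrunc R ι N))) (hlen : N < L.length) :
    L.prod = 0 := by
  rw [← List.take_append_drop (N + 1) L, List.prod_append]
  have h1 := list_prod_mem_prodSpan (L.take (N + 1)) (fun x hx => hL x (List.mem_of_mem_take hx))
  rw [List.length_take, Nat.min_eq_left (by omega), prodSpan_succ_eq_bot, Submodule.mem_bot] at h1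
  rw [h1, zero_mul]

/-- Weight-one elements are `(N+1)`-nilpotent. [folklore] -/
theorem pow_eq_zero_of_mem_genSpan {x : DrinfeldKohnoTrunc R ι N}
    (hx : x ∈ (genSpan : Submodule R (DrinfeldKohnoTrunc R ι N))) : x ^ (N + 1) = 0 := by
  have h := list_prod_eq_zero_of_mem_genSpan (List.replicate (N + 1) x)
    (fun y hy => by rwa [List.eq_of_mem_replicate hy]) (by simp)
  rwa [List.prod_replicate] at h

/-- Substitutions with weight-one values are `(N+1)`-nilpotent. [folklore] -/
theorem prod_map_eq_zero_of_mem_genSpan {β : Type*} (v : β → DrinfeldKohnoTrunc R ι N)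
    (hv : ∀ b, v b ∈ (genSpan : Submodule R (DrinfeldKohnoTrunc R ι N))) (w : List β)
    (hw : N < w.length) : (w.map v).prod = 0 :=
  list_prod_eq_zero_of_mem_genSpan _
    (fun x hx => by obtain ⟨b, -, rfl⟩ := List.mem_map.mp hx; exact hv b) (by simpa using hw)

end DrinfeldKohnoTrunc

/-! ## 3. The 3-cycle relation and the evaluated 2-cycle relation -/

namespace NCSeries

section Eval

variable {R : Type v} [CommSemiring R] {A : Type*} [Semiring A] [Algebra R A]

/-- An element commuting with `a, b` commutes with `φ(a, b)`. [folklore] -/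
theorem commute_evalTrunc_bsub {e a b : A} (ha : Commute e a) (hb : Commute e b) (N : ℕ)
    (φ : NCSeries Bool R) : Commute e (evalTrunc N (bsub a b) φ) := by
  rw [evalTrunc_eq_sum_wordsLE]
  exact Commute.sum_right _ _ _ fun w _ => (commute_prod_map_bsub ha hb w).smul_right _

/-- **Evaluating the exchanged series exchanges the arguments**: `(φ(Y,X))(a, b) = φ(b, a)`.
[folklore] -/
theorem evalTrunc_swapXY (N : ℕ) (a b : A) (φ : NCSeries Bool R) :
    evalTrunc N (bsub a b) (swapXY φ) = evalTrunc N (bsub b a) φ := by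
  rw [evalTrunc_eq_sum_wordsLE, evalTrunc_eq_sum_wordsLE]
  refine Finset.sum_nbij' (fun w => w.map not) (fun w => w.map not) (fun w hw => ?_)
    (fun w hw => ?_) (fun w _ => ?_) (fun w _ => ?_) (fun w _ => ?_)
  · simpa using hw
  · simpa using hw
  · simp [Function.comp_def]
  · simp [Function.comp_def]
  · have e : (bsub b a ∘ not) = bsub a b := by funext c; cases c <;> rfl
    rw [swapXY_apply, List.map_map, e]

end Eval

section TwoCycleEval

variable {k : Type u} [CommRing k] {A : Type*} [Ring A] [Algebra k A]

/-- **The evaluated 2-cycle relation**: if `φ(X,Y) φ(Y,X) = 1 = φ(Y,X) φ(X,Y)` then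
`φ(a,b) φ(b,a) = 1 = φ(b,a) φ(a,b)` for every `(N+1)`-nilpotent pair `(a, b)`. [cite: Furusho2010, Lemma 6] -/
theorem two_cycle_eval {φ : NCSeries Bool k} (h2 : φ * swapXY φ = 1 ∧ swapXY φ * φ = 1) (N : ℕ)
    {a b : A} (hv : ∀ w : List Bool, N < w.length → (w.map (bsub a b)).prod = 0) :
    evalTrunc N (bsub a b) φ * evalTrunc N (bsub b a) φ = 1 ∧
      evalTrunc N (bsub b a) φ * evalTrunc N (bsub a b) φ = 1 := by
  have e1 := congrArg (evalTrunc N (bsub a b)) h2.1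
  have e2 := congrArg (evalTrunc N (bsub a b)) h2.2
  rw [evalTrunc_mul N _ hv, evalTrunc_swapXY, evalTrunc_one (R := k) N (bsub a b)] at e1 e2
  exact ⟨e1, e2⟩

/-- A two-sided inverse is the `Ring.inverse`. [folklore] -/
theorem ring_inverse_eq_of_mul_eq_one {a b : A} (h1 : a * b = 1) (h2 : b * a = 1) :
    Ring.inverse a = b :=
  Ring.inverse_unit ⟨a, b, h1, h2⟩

end TwoCycleEval

section ThreeCycleDef

variable {k : Type u} [CommRing k] [Algebra ℚ k]

/-- **Furusho's 3-cycle relation** `(13)` for a pair `(μ, φ)` [Furusho2010, Lemma 7]: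
`e^{μX/2} φ(Z, X) e^{μZ/2} φ(Y, Z) e^{μY/2} φ(X, Y) = 1` with `X + Y + Z = 0`, an identity in
`U𝔉₂ = k⟨⟨X,Y⟩⟩`, stated as the family of its images in the truncated free algebras
`k⟨⟨X,Y⟩⟩/(deg > N) = NCSeries Bool k ⧸ truncIdeal Bool k N` (`x, y` the classes of `X₀, X₁`,
`e^{·}` the truncated exponential, exact on these nilpotent arguments; `μ/2` written
`(1/2 : ℚ) • μ` as in `NCSeries.DrinfeldHexagon`). [cite: Furusho2010, Lemma 7 (13)] -/
def ThreeCycle (μ : k) (φ : NCSeries Bool k) : Prop :=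
  ∀ N : ℕ,
    truncExp k N (((1 / 2 : ℚ) • μ) • Ideal.Quotient.mk (truncIdeal Bool k N) X₀) *
              evalTrunc N (bsub (-(Ideal.Quotient.mk (truncIdeal Bool k N) X₀) -
                  Ideal.Quotient.mk (truncIdeal Bool k N) X₁)
                (Ideal.Quotient.mk (truncIdeal Bool k N) X₀)) φ *
            truncExp k N (((1 / 2 : ℚ) • μ) • (-(Ideal.Quotient.mk (truncIdeal Bool k N) X₀) -
                Ideal.Quotient.mk (truncIdeal Bool k N) X₁)) *
          evalTrunc N (bsub (Ideal.Quotient.mk (truncIdeal Bool k N) X₁)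
              (-(Ideal.Quotient.mk (truncIdeal Bool k N) X₀) -
                Ideal.Quotient.mk (truncIdeal Bool k N) X₁)) φ *
        truncExp k N (((1 / 2 : ℚ) • μ) • Ideal.Quotient.mk (truncIdeal Bool k N) X₁) *
      evalTrunc N (bsub (Ideal.Quotient.mk (truncIdeal Bool k N) X₀)
          (Ideal.Quotient.mk (truncIdeal Bool k N) X₁)) φ = 1

end ThreeCycleDef

/-! ## 4. Hexagons from the 2- and 3-cycle relations [Furusho2010, Lemma 7] -/

section Hexagon

variable {k : Type u} [CommRing k] [Algebra ℚ k]

/-- The image of the 3-cycle relation under `X ↦ a, Y ↦ b` into `U𝔞₄ ⊗ k/(deg > N)` for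
weight-one `a, b`: `e^{μa/2} φ(-a-b, a) e^{μ(-a-b)/2} φ(b, -a-b) e^{μb/2} φ(a, b) = 1`.
[cite: Furusho2010, Lemma 7] -/
theorem ThreeCycle.eval {μ : k} {φ : NCSeries Bool k} (h3 : ThreeCycle μ φ) (N : ℕ)
    (a b : DrinfeldKohnoTrunc k (Fin 4) N)
    (ha : a ∈ (DrinfeldKohnoTrunc.genSpan : Submodule k (DrinfeldKohnoTrunc k (Fin 4) N)))
    (hb : b ∈ (DrinfeldKohnoTrunc.genSpan : Submodule k (DrinfeldKohnoTrunc k (Fin 4) N))) :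
    truncExp k N (((1 / 2 : ℚ) • μ) • a) * evalTrunc N (bsub (-a - b) a) φ *
          truncExp k N (((1 / 2 : ℚ) • μ) • (-a - b)) * evalTrunc N (bsub b (-a - b)) φ *
        truncExp k N (((1 / 2 : ℚ) • μ) • b) * evalTrunc N (bsub a b) φ = 1 := by
  have hv : ∀ w : List Bool, N < w.length → (w.map (bsub a b)).prod = 0 :=
    DrinfeldKohnoTrunc.prod_map_eq_zero_of_mem_genSpan _ (fun c => by cases c <;> assumption)
  have h := congrArg (evalQuotHom N (bsub a b) hv) (h3 N)
  have hx : evalQuotHom N (bsub a b) hv (Ideal.Quotient.mk (truncIdeal Bool k N) X₀) = a := by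
    rw [evalQuotHom_mk]; exact evalTrunc_letter N _ hv false
  have hy : evalQuotHom N (bsub a b) hv (Ideal.Quotient.mk (truncIdeal Bool k N) X₁) = b := by
    rw [evalQuotHom_mk]; exact evalTrunc_letter N _ hv true
  simp only [map_mul, map_one, map_truncExp, map_smul, map_sub, map_neg, algHom_evalTrunc,
    comp_bsub, hx, hy] at h
  exact h

/-- **[Furusho2010, Lemma 7 (⇐)]: the 2-cycle and 3-cycle relations imply both hexagon
equations.** Let `φ ∈ k⟨⟨X,Y⟩⟩` (`k` a commutative `ℚ`-algebra) be group-like with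
`c_X(φ) = c_Y(φ) = 0`, satisfying the 2-cycle relation `φ(X,Y)φ(Y,X) = 1` and the 3-cycle
relation (13) for `μ`. Then `(μ, φ)` satisfies `NCSeries.DrinfeldHexagon` and
`NCSeries.DrinfeldHexagonB`. Proof as printed: with `X = t₁₂, Y = t₂₃` (strands `0,1,2` here),
`c = t₁₂ + t₁₃ + t₂₃` commutes with `t₁₂, t₁₃, t₂₃`, `t₁₃ = Z + c` with `Z = -X - Y`, the
central shifts give `φ(t₁₃, ·) = φ(Z, ·)`, `φ(·, t₁₃) = φ(·, Z)`, `e^{μt₁₃/2} = e^{μc/2}e^{μZ/2}`,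
and the two hexagons become (13) and (13) with `X, Y` exchanged. [cite: Furusho2010, Lemma 7] -/
theorem drinfeldHexagons_of_threeCycle {φ : NCSeries Bool k} (hg : IsGroupLike φ)
    (h0 : φ [false] = 0) (h1 : φ [true] = 0) (h2 : φ * swapXY φ = 1 ∧ swapXY φ * φ = 1) {μ : k}
    (h3 : ThreeCycle μ φ) : DrinfeldHexagon μ φ ∧ DrinfeldHexagonB μ φ := by
  -- common notation and facts, for each truncation level
  have main : ∀ N : ℕ,
      let P1 : DrinfeldKohnoTrunc k (Fin 4) N := t₄ k N 0 1
      let P2 : DrinfeldKohnoTrunc k (Fin 4) N := t₄ k N 1 2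
      let P3 : DrinfeldKohnoTrunc k (Fin 4) N := t₄ k N 0 2
      DrinfeldKohnoTrunc.expT (((1 / 2 : ℚ) • μ) • (P3 + P2)) =
          evalTrunc N (bsub P3 P1) φ * DrinfeldKohnoTrunc.expT (((1 / 2 : ℚ) • μ) • P3) *
            Ring.inverse (evalTrunc N (bsub P3 P2) φ) *
            DrinfeldKohnoTrunc.expT (((1 / 2 : ℚ) • μ) • P2) * evalTrunc N (bsub P1 P2) φ ∧
        DrinfeldKohnoTrunc.expT (((1 / 2 : ℚ) • μ) • (P1 + P3)) =
          Ring.inverse (evalTrunc N (bsub P2 P3) φ) *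
            DrinfeldKohnoTrunc.expT (((1 / 2 : ℚ) • μ) • P3) * evalTrunc N (bsub P1 P3) φ *
            DrinfeldKohnoTrunc.expT (((1 / 2 : ℚ) • μ) • P1) *
            Ring.inverse (evalTrunc N (bsub P1 P2) φ) := by
    intro N P1 P2 P3
    -- the central element and the commutation relations
    have hmem1 : P1 ∈ (DrinfeldKohnoTrunc.genSpan : Submodule k (DrinfeldKohnoTrunc k (Fin 4) N)) :=
      DrinfeldKohnoTrunc.t_mem_genSpan 0 1
    have hmem2 : P2 ∈ (DrinfeldKohnoTrunc.genSpan : Submodule k (DrinfeldKohnoTrunc k (Fin 4) N)) :=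
      DrinfeldKohnoTrunc.t_mem_genSpan 1 2
    have hmem3 : P3 ∈ (DrinfeldKohnoTrunc.genSpan : Submodule k (DrinfeldKohnoTrunc k (Fin 4) N)) :=
      DrinfeldKohnoTrunc.t_mem_genSpan 0 2
    set m : k := (1 / 2 : ℚ) • μ with hm
    set c : DrinfeldKohnoTrunc k (Fin 4) N := P1 + P3 + P2 with hc
    set z : DrinfeldKohnoTrunc k (Fin 4) N := -P1 - P2 with hz
    have hmemc : c ∈ (DrinfeldKohnoTrunc.genSpan : Submodule k (DrinfeldKohnoTrunc k (Fin 4) N)) :=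
      Submodule.add_mem _ (Submodule.add_mem _ hmem1 hmem3) hmem2
    have hmemz : z ∈ (DrinfeldKohnoTrunc.genSpan : Submodule k (DrinfeldKohnoTrunc k (Fin 4) N)) :=
      Submodule.sub_mem _ (Submodule.neg_mem _ hmem1) hmem2
    have hP1c : Commute P1 c := by
      rw [hc, add_assoc]
      exact (Commute.refl P1).add_right (DrinfeldKohnoTrunc.t_mul_add 0 1 2 (by decide)
        (by decide) (by decide))
    have hP2c : Commute P2 c := by
      have h := DrinfeldKohnoTrunc.t_mul_add (R := k) (N := N) (1 : Fin 4) 2 0 (by decide)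
        (by decide) (by decide)
      rw [DrinfeldKohnoTrunc.t_symm (1 : Fin 4) 0, DrinfeldKohnoTrunc.t_symm (2 : Fin 4) 0] at h
      have h' : Commute P2 (P1 + P3) := h
      have : c = (P1 + P3) + P2 := by rw [hc]
      rw [this]
      exact h'.add_right (Commute.refl P2)
    have hcP1 : Commute c P1 := hP1c.symm
    have hcP2 : Commute c P2 := hP2c.symm
    have hcz : Commute c z := (hcP1.neg_right).sub_right hcP2
    have hP3 : P3 = z + c := by rw [hz, hc]; abel
    -- nilpotency
    have hnil : ∀ {x : DrinfeldKohnoTrunc k (Fin 4) N},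
        x ∈ (DrinfeldKohnoTrunc.genSpan : Submodule k (DrinfeldKohnoTrunc k (Fin 4) N)) →
          (m • x) ^ (N + 1) = 0 :=
      fun hx => DrinfeldKohnoTrunc.pow_eq_zero_of_mem_genSpan (Submodule.smul_mem _ _ hx)
    have hvz2 : ∀ w : List Bool, N < w.length → (w.map (bsub z P2)).prod = 0 :=
      DrinfeldKohnoTrunc.prod_map_eq_zero_of_mem_genSpan _ (fun b => by cases b <;> assumption)
    have hv12 : ∀ w : List Bool, N < w.length → (w.map (bsub P1 P2)).prod = 0 :=
      DrinfeldKohnoTrunc.prod_map_eq_zero_of_mem_genSpan _ (fun b => by cases b <;> assumption)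
    -- exponentials: e^{m t₁₃} = e^{mc} e^{mZ}, e^{m(t₁₃+t₂₃)} = e^{mc} e^{-m X}, etc.
    have ec3 : truncExp k N (m • P3) = truncExp k N (m • c) * truncExp k N (m • z) := by
      rw [hP3, smul_add, add_comm]
      refine truncExp_add_of_commute N ((hcz.smul_left m).smul_right m) (hnil hmemc) (hnil hmemz) ?_
      rw [← smul_add, add_comm, ← hP3]; exact hnil hmem3
    have eL1 : truncExp k N (m • (P3 + P2)) = truncExp k N (m • c) * truncExp k N (-(m • P1)) := by
      have e : P3 + P2 = c + -P1 := by rw [hc]; abel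
      rw [e, smul_add, smul_neg]
      refine truncExp_add_of_commute N ((hcP1.smul_left m).smul_right m).neg_right (hnil hmemc)
        (by rw [neg_pow, hnil hmem1, mul_zero]) ?_
      rw [← smul_neg, ← smul_add, ← e]
      exact hnil (Submodule.add_mem _ hmem3 hmem2)
    have eL2 : truncExp k N (m • (P1 + P3)) = truncExp k N (m • c) * truncExp k N (-(m • P2)) := by
      have e : P1 + P3 = c + -P2 := by rw [hc]; abel
      rw [e, smul_add, smul_neg]
      refine truncExp_add_of_commute N ((hcP2.smul_left m).smul_right m).neg_right (hnil hmemc)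
        (by rw [neg_pow, hnil hmem2, mul_zero]) ?_
      rw [← smul_neg, ← smul_add, ← e]
      exact hnil (Submodule.add_mem _ hmem1 hmem3)
    -- central shifts
    have s31 : evalTrunc N (bsub P3 P1) φ = evalTrunc N (bsub z P1) φ := by
      rw [hP3]; exact hg.evalTrunc_bsub_add_left h0 N hcz hcP1
    have s32 : evalTrunc N (bsub P3 P2) φ = evalTrunc N (bsub z P2) φ := by
      rw [hP3]; exact hg.evalTrunc_bsub_add_left h0 N hcz hcP2
    have s23 : evalTrunc N (bsub P2 P3) φ = evalTrunc N (bsub P2 z) φ := by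
      rw [hP3]; exact hg.evalTrunc_bsub_add_right h1 N hcP2 hcz
    have s13 : evalTrunc N (bsub P1 P3) φ = evalTrunc N (bsub P1 z) φ := by
      rw [hP3]; exact hg.evalTrunc_bsub_add_right h1 N hcP1 hcz
    -- inverses from the 2-cycle relation
    have iz2 : Ring.inverse (evalTrunc N (bsub z P2) φ) = evalTrunc N (bsub P2 z) φ :=
      ring_inverse_eq_of_mul_eq_one (two_cycle_eval h2 N hvz2).1 (two_cycle_eval h2 N hvz2).2
    have i2z : Ring.inverse (evalTrunc N (bsub P2 z) φ) = evalTrunc N (bsub z P2) φ :=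
      ring_inverse_eq_of_mul_eq_one (two_cycle_eval h2 N hvz2).2 (two_cycle_eval h2 N hvz2).1
    have i12 : Ring.inverse (evalTrunc N (bsub P1 P2) φ) = evalTrunc N (bsub P2 P1) φ :=
      ring_inverse_eq_of_mul_eq_one (two_cycle_eval h2 N hv12).1 (two_cycle_eval h2 N hv12).2
    -- the 3-cycle relation evaluated at (X,Y) ↦ (P1,P2) and (P2,P1)
    have t12 := h3.eval N P1 P2 hmem1 hmem2
    have t21 := h3.eval N P2 P1 hmem2 hmem1
    have ez21 : -P2 - P1 = z := by rw [hz]; abel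
    rw [ez21] at t21
    change truncExp k N (m • P1) * evalTrunc N (bsub z P1) φ * truncExp k N (m • z) *
        evalTrunc N (bsub P2 z) φ * truncExp k N (m • P2) * evalTrunc N (bsub P1 P2) φ = 1 at t12
    change truncExp k N (m • P2) * evalTrunc N (bsub z P2) φ * truncExp k N (m • z) *
        evalTrunc N (bsub P1 z) φ * truncExp k N (m • P1) * evalTrunc N (bsub P2 P1) φ = 1 at t21
    have q12 : evalTrunc N (bsub z P1) φ * (truncExp k N (m • z) * (evalTrunc N (bsub P2 z) φ *
        (truncExp k N (m • P2) * evalTrunc N (bsub P1 P2) φ))) = truncExp k N (-(m • P1)) := by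
      calc _ = truncExp k N (-(m • P1)) * truncExp k N (m • P1) * (evalTrunc N (bsub z P1) φ *
            (truncExp k N (m • z) * (evalTrunc N (bsub P2 z) φ *
              (truncExp k N (m • P2) * evalTrunc N (bsub P1 P2) φ)))) := by
            rw [truncExp_neg_mul_truncExp N (hnil hmem1), one_mul]
        _ = truncExp k N (-(m • P1)) * (truncExp k N (m • P1) * evalTrunc N (bsub z P1) φ *
            truncExp k N (m • z) * evalTrunc N (bsub P2 z) φ * truncExp k N (m • P2) *
              evalTrunc N (bsub P1 P2) φ) := by simp only [mul_assoc]
        _ = truncExp k N (-(m • P1)) := by rw [t12, mul_one]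
    have q21 : evalTrunc N (bsub z P2) φ * (truncExp k N (m • z) * (evalTrunc N (bsub P1 z) φ *
        (truncExp k N (m • P1) * evalTrunc N (bsub P2 P1) φ))) = truncExp k N (-(m • P2)) := by
      calc _ = truncExp k N (-(m • P2)) * truncExp k N (m • P2) * (evalTrunc N (bsub z P2) φ *
            (truncExp k N (m • z) * (evalTrunc N (bsub P1 z) φ *
              (truncExp k N (m • P1) * evalTrunc N (bsub P2 P1) φ)))) := by
            rw [truncExp_neg_mul_truncExp N (hnil hmem2), one_mul]
        _ = truncExp k N (-(m • P2)) * (truncExp k N (m • P2) * evalTrunc N (bsub z P2) φ *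
            truncExp k N (m • z) * evalTrunc N (bsub P1 z) φ * truncExp k N (m • P1) *
              evalTrunc N (bsub P2 P1) φ) := by simp only [mul_assoc]
        _ = truncExp k N (-(m • P2)) := by rw [t21, mul_one]
    -- `e^{mc}` commutes with `φ(Z, ·)`
    have cz1 : Commute (truncExp k N (m • c)) (evalTrunc N (bsub z P1) φ) :=
      (Commute.truncExp_right (R := k)
        (commute_evalTrunc_bsub (hcz.smul_left m) (hcP1.smul_left m) N φ).symm N).symm
    have cz2 : Commute (truncExp k N (m • c)) (evalTrunc N (bsub z P2) φ) :=
      (Commute.truncExp_right (R := k)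
        (commute_evalTrunc_bsub (hcz.smul_left m) (hcP2.smul_left m) N φ).symm N).symm
    refine ⟨?_, ?_⟩
    · simp only [DrinfeldKohnoTrunc.expT_eq_truncExp]
      rw [eL1, s31, s32, iz2, ec3]
      calc truncExp k N (m • c) * truncExp k N (-(m • P1))
          = truncExp k N (m • c) * (evalTrunc N (bsub z P1) φ * (truncExp k N (m • z) *
              (evalTrunc N (bsub P2 z) φ * (truncExp k N (m • P2) * evalTrunc N (bsub P1 P2) φ)))) := by
            rw [q12]
        _ = evalTrunc N (bsub z P1) φ * truncExp k N (m • c) * truncExp k N (m • z) *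
              evalTrunc N (bsub P2 z) φ * truncExp k N (m • P2) * evalTrunc N (bsub P1 P2) φ := by
            rw [← mul_assoc, cz1.eq]; simp only [mul_assoc]
        _ = _ := by simp only [mul_assoc]
    · simp only [DrinfeldKohnoTrunc.expT_eq_truncExp]
      rw [eL2, s23, s13, i2z, i12, ec3]
      calc truncExp k N (m • c) * truncExp k N (-(m • P2))
          = truncExp k N (m • c) * (evalTrunc N (bsub z P2) φ * (truncExp k N (m • z) *
              (evalTrunc N (bsub P1 z) φ * (truncExp k N (m • P1) * evalTrunc N (bsub P2 P1) φ)))) := by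
            rw [q21]
        _ = evalTrunc N (bsub z P2) φ * truncExp k N (m • c) * truncExp k N (m • z) *
              evalTrunc N (bsub P1 z) φ * truncExp k N (m • P1) * evalTrunc N (bsub P2 P1) φ := by
            rw [← mul_assoc, cz2.eq]; simp only [mul_assoc]
        _ = _ := by simp only [mul_assoc]
  exact ⟨fun N => (main N).1, fun N => (main N).2⟩

end Hexagon

end NCSeries

end Literature.NumberTheory.Transcendental
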